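import Summits.FinalStateConjecture.FinalStateConjecture.Theorems.EIHFluxBalanceInertialRecessionStubCoerMomKernelLimit

/-!
# Route EIHFluxBalance — `InertialRecession` (E′), line `SketchCleanExcision`, skeleton r13,
# stub `stub_coerMomKernel` (Bk), part 5b: STEP TWO of the graded limit (the spin/translation row)

Helper file for the crux `stmt-FinalStateConjecture-17403`
(`Summit.FinalStateConjecture.FinalStateConjecture.Theses.EIHFluxBalance.InertialRecession`, E′),
registered stub `stub_coerMomKernel` (Bk) of skeleton r13 (seat 1):

* `bk_tendsto_inv_smul_of_hasDerivAt` — `t⁻¹ • f t → f'(0)` along `t → 0`, `t ≠ 0`, when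
  `f 0 = 0` (one-line registered carrier `bk_limit_carrier`);
* **`bk_step_two`** — from the scaled identity of part 3 and `A e₀ = 0`: dividing by `ε` and letting
  `ε → 0⁺`, `a · row(η; spinVar_{(1,A,0)}) + row(η; Var_{(1,0,0,d)}) = 0` at every slice point
  (difference quotients in the spin via `bk_hasDerivAt_var_spin` / `bk_hasDerivAt_fderiv_var_spin`,
  continuity of the row functional in the jets, part 5a).

No definitions, no named facts, no `sorry`.
-/

set_option linter.dupNamespace false
set_option maxSynthPendingDepth 3

noncomputable section

open Set Function Filter ContinuousLinearMap Literature.Geometry.Lorentzian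
  Literature.Geometry.Lorentzian.MetricCoord
open scoped Topology ContDiff

namespace Summit.FinalStateConjecture.FinalStateConjecture.Theorems.SublinearIsFree.Slaving

/-! ### Step two: the flat rows of the spin dipole and of the translation -/

/-- Difference quotients of a function vanishing at `0` converge to its derivative there. [folklore] -/
theorem bk_tendsto_inv_smul_of_hasDerivAt {F : Type*} [NormedAddCommGroup F] [NormedSpace ℝ F]
    {f : ℝ → F} {f' : F} (hf : HasDerivAt f f' 0) (hf0 : f 0 = 0) :
    Tendsto (fun t : ℝ ↦ t⁻¹ • f t) (𝓝[≠] 0) (𝓝 f') := by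
  have h := hasDerivAt_iff_tendsto_slope_zero.1 hf
  have hfun : (fun t : ℝ ↦ t⁻¹ • (f (0 + t) - f 0)) = fun t ↦ t⁻¹ • f t := by
    funext t; rw [zero_add, hf0, sub_zero]
  rwa [hfun] at h

set_option maxHeartbeats 6400000 in
/-- **Step two of the graded limit.** Let `A` be an infinitesimal ROTATION (`η`-skew, `A e₀ = 0`),
so that `Var_{(1,0,A,0)} = 0` near `x` (Schwarzschild is spherically symmetric,
`coerMomQ_var_stab_eq_zero`), and `e` spatial. From the scaled identity
`row_ε(A, 0) + ε · row_ε(0, d) = 0` (part 3):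
`a · (flat row of spinVar_{(1,A,0)}) + (flat row of Var_{(1,0,0,d)}) = 0` at `x`.
For `a ≠ 0`: `Var_{(1,εa,A,0)} = εa · Var_{(1,εa,(εa)⁻¹A,0)}`, the rows are homogeneous
(`coerMomQ_row_smul`, ML(i)), so `a · row(K_ε; Var_{(1,εa,(εa)⁻¹A,0)}) + row_ε(0,d) = 0`; the
jets of `(εa)⁻¹ Var_{(1,εa,A,0)}` at `x` are difference quotients converging to the jets of the
spin first-variation field (`bk_hasDerivAt_var_spin`, `bk_hasDerivAt_fderiv_var_spin`), the jets of
`K_ε` converge to those of `η`, and the row functional is continuous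
(`coerMomQ_continuousAt_rowFun`). For `a = 0` the first row vanishes identically. [folklore] -/
theorem bk_step_two (L : lorentzGroup) (M a : ℝ) {A : E4 →L[ℝ] E4}
    (hA : ∀ u w : E4, Minkowski.bilin (A u) w + Minkowski.bilin u (A w) = 0)
    (hA0 : A (E4.basisVector 0) = 0) (d : E4) {x : E4}
    (hx0 : x 0 = 0) (hx : 0 < Kerr.radius 0 (((L : E4 ≃L[ℝ] E4).symm : E4 →L[ℝ] E4) x)) {e : E4}
    (he : e 0 = 0)
    (hid : ∃ ε₀ : ℝ, 0 < ε₀ ∧ ∀ ε : ℝ, 0 < ε → ε < ε₀ →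
      (ricAt (fun z : E4 ↦ boostedKerrBilin L 0 (ε * M) (ε * a) z + (z 0) • ((fderiv ℝ (Kerr.bilin 1 (ε * a)) (((L : E4 ≃L[ℝ] E4).symm : E4 →L[ℝ] E4) z) (A (((L : E4 ≃L[ℝ] E4).symm : E4 →L[ℝ] E4) z) + 0)).bilinearComp ((L : E4 ≃L[ℝ] E4).symm : E4 →L[ℝ] E4) ((L : E4 ≃L[ℝ] E4).symm : E4 →L[ℝ] E4) + (Kerr.bilin 1 (ε * a) (((L : E4 ≃L[ℝ] E4).symm : E4 →L[ℝ] E4) z)).bilinearComp (A.comp ((L : E4 ≃L[ℝ] E4).symm : E4 →L[ℝ] E4)) ((L : E4 ≃L[ℝ] E4).symm : E4 →L[ℝ] E4) + (Kerr.bilin 1 (ε * a) (((L : E4 ≃L[ℝ] E4).symm : E4 →L[ℝ] E4) z)).bilinearComp ((L : E4 ≃L[ℝ] E4).symm : E4 →L[ℝ] E4) (A.comp ((L : E4 ≃L[ℝ] E4).symm : E4 →L[ℝ] E4)))) x (sharpAt (boostedKerrBilin L 0 (ε * M) (ε * a)) x (E4.dx 0)) e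
          - ricAt (boostedKerrBilin L 0 (ε * M) (ε * a)) x (sharpAt (boostedKerrBilin L 0 (ε * M) (ε * a)) x (E4.dx 0)) e)
        + ε * (ricAt (fun z : E4 ↦ boostedKerrBilin L 0 (ε * M) (ε * a) z + (z 0) • ((fderiv ℝ (Kerr.bilin 1 (ε * a)) (((L : E4 ≃L[ℝ] E4).symm : E4 →L[ℝ] E4) z) ((0 : E4 →L[ℝ] E4) (((L : E4 ≃L[ℝ] E4).symm : E4 →L[ℝ] E4) z) + d)).bilinearComp ((L : E4 ≃L[ℝ] E4).symm : E4 →L[ℝ] E4) ((L : E4 ≃L[ℝ] E4).symm : E4 →L[ℝ] E4) + (Kerr.bilin 1 (ε * a) (((L : E4 ≃L[ℝ] E4).symm : E4 →L[ℝ] E4) z)).bilinearComp ((0 : E4 →L[ℝ] E4).comp ((L : E4 ≃L[ℝ] E4).symm : E4 →L[ℝ] E4)) ((L : E4 ≃L[ℝ] E4).symm : E4 →L[ℝ] E4) + (Kerr.bilin 1 (ε * a) (((L : E4 ≃L[ℝ] E4).symm : E4 →L[ℝ] E4) z)).bilinearComp ((L : E4 ≃L[ℝ] E4).symm : E4 →L[ℝ]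 E4) ((0 : E4 →L[ℝ] E4).comp ((L : E4 ≃L[ℝ] E4).symm : E4 →L[ℝ] E4)))) x (sharpAt (boostedKerrBilin L 0 (ε * M) (ε * a)) x (E4.dx 0)) e
          - ricAt (boostedKerrBilin L 0 (ε * M) (ε * a)) x (sharpAt (boostedKerrBilin L 0 (ε * M) (ε * a)) x (E4.dx 0)) e) = 0) :
    a * ricAt (fun z : E4 ↦ Minkowski.bilin + (z 0) • ((fderiv ℝ (Kerr.spinMetric 1) (((L : E4 ≃L[ℝ] E4).symm : E4 →L[ℝ] E4) z) (A (((L : E4 ≃L[ℝ] E4).symm : E4 →L[ℝ] E4) z) + 0)).bilinearComp ((L : E4 ≃L[ℝ] E4).symm : E4 →L[ℝ] E4) ((L : E4 ≃L[ℝ] E4).symm : E4 →L[ℝ] E4) + (Kerr.spinMetric 1 (((L : E4 ≃L[ℝ] E4).symm : E4 →L[ℝ] E4) z)).bilinearComp (A.comp ((L : E4 ≃L[ℝ] E4).symm : E4 →L[ℝ] E4)) ((L : E4 ≃L[ℝ] E4).symm : E4 →L[ℝ] E4) + (Kerr.spinMetric 1 (((L : E4 ≃L[ℝ] E4).symm :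 E4 →L[ℝ] E4) z)).bilinearComp ((L : E4 ≃L[ℝ] E4).symm : E4 →L[ℝ] E4) (A.comp ((L : E4 ≃L[ℝ] E4).symm : E4 →L[ℝ] E4)))) x (sharpAt (fun _ : E4 ↦ Minkowski.bilin) x (E4.dx 0)) e
      + ricAt (fun z : E4 ↦ Minkowski.bilin + (z 0) • ((fderiv ℝ (Kerr.bilin 1 0) (((L : E4 ≃L[ℝ] E4).symm : E4 →L[ℝ] E4) z) ((0 : E4 →L[ℝ] E4) (((L : E4 ≃L[ℝ] E4).symm : E4 →L[ℝ] E4) z) + d)).bilinearComp ((L : E4 ≃L[ℝ] E4).symm : E4 →L[ℝ] E4) ((L : E4 ≃L[ℝ] E4).symm : E4 →L[ℝ] E4) + (Kerr.bilin 1 0 (((L : E4 ≃L[ℝ] E4).symm : E4 →L[ℝ] E4) z)).bilinearComp ((0 : E4 →L[ℝ] E4).comp ((L : E4 ≃L[ℝ] E4).symm : E4 →L[ℝ] E4)) ((L : E4 ≃L[ℝ] E4).symm : E4 →L[ℝ] E4) + (Kerr.bilin 1 0 (((L : E4 ≃L[ℝ] E4).symm : E4 →L[ℝ] E4) z)).bilinearComp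 ((L : E4 ≃L[ℝ] E4).symm : E4 →L[ℝ] E4) ((0 : E4 →L[ℝ] E4).comp ((L : E4 ≃L[ℝ] E4).symm : E4 →L[ℝ] E4)))) x (sharpAt (fun _ : E4 ↦ Minkowski.bilin) x (E4.dx 0)) e = 0 := by
  set S : E4 →L[ℝ] E4 := ((L : E4 ≃L[ℝ] E4).symm : E4 →L[ℝ] E4) with hS
  obtain ⟨ε₀, hε₀, hid⟩ := hid
  have he' : E4.dx 0 e = 0 := he
  -- the translation row and its limit
  obtain ⟨Φd, hΦd⟩ : ∃ f : ℝ → ℝ, f = fun ε : ℝ ↦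
      ricAt (fun z : E4 ↦ boostedKerrBilin L 0 (ε * M) (ε * a) z + (z 0) • ((fderiv ℝ (Kerr.bilin 1 (ε * a)) (S z) ((0 : E4 →L[ℝ] E4) (S z) + d)).bilinearComp S S + (Kerr.bilin 1 (ε * a) (S z)).bilinearComp ((0 : E4 →L[ℝ] E4).comp S) S + (Kerr.bilin 1 (ε * a) (S z)).bilinearComp S ((0 : E4 →L[ℝ] E4).comp S))) x (sharpAt (boostedKerrBilin L 0 (ε * M) (ε * a)) x (E4.dx 0)) e
        - ricAt (boostedKerrBilin L 0 (ε * M) (ε * a)) x (sharpAt (boostedKerrBilin L 0 (ε * M) (ε * a)) x (E4.dx 0)) e := ⟨_, rfl⟩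
  have cd : ContinuousAt Φd 0 := by rw [hΦd]; exact bk_continuousAt_row L M a 0 d hx0 hx e
  have hdlim : Tendsto Φd (𝓝[>] 0) (𝓝 (Φd 0)) := cd.tendsto.mono_left nhdsWithin_le_nhds
  have hd0 : Φd 0 = ricAt (fun z : E4 ↦ Minkowski.bilin + (z 0) • ((fderiv ℝ (Kerr.bilin 1 0) (S z) ((0 : E4 →L[ℝ] E4) (S z) + d)).bilinearComp S S + (Kerr.bilin 1 0 (S z)).bilinearComp ((0 : E4 →L[ℝ] E4).comp S) S + (Kerr.bilin 1 0 (S z)).bilinearComp S ((0 : E4 →L[ℝ] E4).comp S))) x (sharpAt (fun _ : E4 ↦ Minkowski.bilin) x (E4.dx 0)) e := by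
    rw [hΦd]
    exact bk_row_zero L M a 0 d x e
  -- the stabiliser: `Var_{(1,0,A,0)}` vanishes off the painted time axis
  have hU : IsOpen {z : E4 | 0 < Kerr.radius 0 (S z)} :=
    isOpen_lt continuous_const ((Kerr.continuous_radius 0).comp S.continuous)
  have hstab : ∀ z : E4, 0 < Kerr.radius 0 (S z) →
      (fderiv ℝ (Kerr.bilin 1 0) (S z) (A (S z) + 0)).bilinearComp S S
        + (Kerr.bilin 1 0 (S z)).bilinearComp (A.comp S) S
        + (Kerr.bilin 1 0 (S z)).bilinearComp S (A.comp S) = 0 := fun z hz ↦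
    coerMomQ_var_stab_eq_zero 1 0 S hA hA0 (fun h ↦ absurd rfl h) (by simp) hz
  -- positivity of the painted radius near `ε = 0`
  have hev_rad : ∀ᶠ ε : ℝ in 𝓝 0, 0 < Kerr.radius (ε * a) (S x) := by
    have hca : Tendsto (fun ε : ℝ ↦ ε * a) (𝓝 0) (𝓝 0) := by
      have h := (tendsto_id (x := 𝓝 (0 : ℝ))).mul_const a
      rw [zero_mul] at h
      exact h
    exact hca.eventually (Kerr.eventually_radius_pos hx)
  by_cases ha : a = 0
  · -- `a = 0`: the first row vanishes identically
    subst ha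
    have hzero : ∀ᶠ ε : ℝ in 𝓝[>] 0, Φd ε = 0 := by
      filter_upwards [Ioo_mem_nhdsGT hε₀] with ε hε
      have h := hid ε hε.1 hε.2
      -- the modulated model with `Var_{(1,0,A,0)}` IS the painted summand near `x`
      have hcongr : ricAt (fun z : E4 ↦ boostedKerrBilin L 0 (ε * M) (ε * 0) z + (z 0) • ((fderiv ℝ (Kerr.bilin 1 (ε * 0)) (S z) (A (S z) + 0)).bilinearComp S S + (Kerr.bilin 1 (ε * 0) (S z)).bilinearComp (A.comp S) S + (Kerr.bilin 1 (ε * 0) (S z)).bilinearComp S (A.comp S))) x = ricAt (boostedKerrBilin L 0 (ε * M) (ε * 0)) x := by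
        refine coerMomQ_ricAt_congr ?_
        filter_upwards [hU.mem_nhds hx] with z hz
        rw [mul_zero, hstab z hz, smul_zero, add_zero]
      rw [hcongr, sub_self, zero_add] at h
      rw [hΦd]
      exact (mul_eq_zero.1 h).resolve_left hε.1.ne'
    have hlim0 : Tendsto Φd (𝓝[>] 0) (𝓝 0) :=
      tendsto_const_nhds.congr' (hzero.mono fun ε hε ↦ hε.symm)
    have h00 : Φd 0 = 0 := tendsto_nhds_unique hdlim hlim0
    rw [zero_mul, zero_add, ← hd0, h00]
  · -- `a ≠ 0`: the family in frame form
    obtain ⟨KSf, hKSf⟩ : ∃ KSf : ℝ → E4 → E4 →L[ℝ] E4 →L[ℝ] ℝ,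
        KSf = fun ε z ↦ (Kerr.bilin (ε * M) (ε * a) (S z)).bilinearComp S S := ⟨_, rfl⟩
    have hKf : ∀ ε : ℝ, boostedKerrBilin L 0 (ε * M) (ε * a) = KSf ε := fun ε ↦ by
      rw [hKSf, coerMomQ_boostedKerrBilin_eq_frame]
    -- the first-variation family, its rescaling, and the spin first-variation field
    obtain ⟨Vf, hVf⟩ : ∃ Vf : ℝ → E4 → E4 →L[ℝ] E4 →L[ℝ] ℝ,
        Vf = fun a' z ↦ ((fderiv ℝ (Kerr.bilin 1 a') (S z) (A (S z) + 0)).bilinearComp S S + (Kerr.bilin 1 a' (S z)).bilinearComp (A.comp S) S + (Kerr.bilin 1 a' (S z)).bilinearComp S (A.comp S)) := ⟨_, rfl⟩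
    obtain ⟨Wf, hWf⟩ : ∃ Wf : ℝ → E4 → E4 →L[ℝ] E4 →L[ℝ] ℝ,
        Wf = fun a' z ↦ ((fderiv ℝ (Kerr.bilin 1 a') (S z) ((a'⁻¹ • A) (S z) + 0)).bilinearComp S S + (Kerr.bilin 1 a' (S z)).bilinearComp ((a'⁻¹ • A).comp S) S + (Kerr.bilin 1 a' (S z)).bilinearComp S ((a'⁻¹ • A).comp S)) := ⟨_, rfl⟩
    have hWV : ∀ a' : ℝ, Wf a' = fun z ↦ a'⁻¹ • Vf a' z := by
      intro a'
      rw [hWf, hVf]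
      funext z
      have h := coerMomQ_var_smul 1 a' S A 0 z a'⁻¹
      rw [smul_zero] at h
      exact h
    obtain ⟨Sp, hSp⟩ : ∃ Sp : E4 → E4 →L[ℝ] E4 →L[ℝ] ℝ,
        Sp = fun z ↦ ((fderiv ℝ (Kerr.spinMetric 1) (S z) (A (S z) + 0)).bilinearComp S S + (Kerr.spinMetric 1 (S z)).bilinearComp (A.comp S) S + (Kerr.spinMetric 1 (S z)).bilinearComp S (A.comp S)) := ⟨_, rfl⟩
    -- the rescaled row `Ψ`
    obtain ⟨Ψ, hΨ⟩ : ∃ f : ℝ → ℝ, f = fun ε : ℝ ↦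
        ricAt (fun z : E4 ↦ KSf ε z + (z 0) • Wf (ε * a) z) x (sharpAt (KSf ε) x (E4.dx 0)) e
          - ricAt (KSf ε) x (sharpAt (KSf ε) x (E4.dx 0)) e := ⟨_, rfl⟩
    -- (s1)+(s2): `a Ψ ε + Φd ε = 0` for small `ε > 0`
    have hid2 : ∀ᶠ ε : ℝ in 𝓝[>] 0, a * Ψ ε + Φd ε = 0 := by
      have h1 : ∀ᶠ ε : ℝ in 𝓝[>] 0, 0 < Kerr.radius (ε * a) (S x) :=
        hev_rad.filter_mono nhdsWithin_le_nhds
      filter_upwards [Ioo_mem_nhdsGT hε₀, h1] with ε hε hεr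
      have h := hid ε hε.1 hε.2
      have hεa : ε * a ≠ 0 := mul_ne_zero hε.1.ne' ha
      have hKm : IsMetricOn (boostedKerrBilin L 0 (ε * M) (ε * a))
          (poincareInv L 0 ⁻¹' (Kerr.region (ε * a) 0 : Set E4)) :=
        bk_isMetricOn_boostedKerrBilin L (ε * M) (ε * a)
      have hxK : x ∈ poincareInv L 0 ⁻¹' (Kerr.region (ε * a) 0 : Set E4) :=
        (bk_mem_region_iff L _ x).2 hεr
      have hsm := coerMomQ_row_smul stub_momRowLinear.1 hKm hxK hx0 1 (ε * a) S ((ε * a)⁻¹ • A) 0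
        hεr (ε * a) e he'
      rw [smul_smul, mul_inv_cancel₀ hεa, one_smul, smul_zero] at hsm
      have hΨε : Ψ ε = ricAt (fun z : E4 ↦ boostedKerrBilin L 0 (ε * M) (ε * a) z + (z 0) • ((fderiv ℝ (Kerr.bilin 1 (ε * a)) (S z) (((ε * a)⁻¹ • A) (S z) + 0)).bilinearComp S S + (Kerr.bilin 1 (ε * a) (S z)).bilinearComp (((ε * a)⁻¹ • A).comp S) S + (Kerr.bilin 1 (ε * a) (S z)).bilinearComp S (((ε * a)⁻¹ • A).comp S))) x (sharpAt (boostedKerrBilin L 0 (ε * M) (ε * a)) x (E4.dx 0)) e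
          - ricAt (boostedKerrBilin L 0 (ε * M) (ε * a)) x (sharpAt (boostedKerrBilin L 0 (ε * M) (ε * a)) x (E4.dx 0)) e := by
        rw [hΨ, hWf, hKf]
      rw [← hΨε] at hsm
      rw [hsm] at h
      have hΦdε : Φd ε = ricAt (fun z : E4 ↦ boostedKerrBilin L 0 (ε * M) (ε * a) z + (z 0) • ((fderiv ℝ (Kerr.bilin 1 (ε * a)) (S z) ((0 : E4 →L[ℝ] E4) (S z) + d)).bilinearComp S S + (Kerr.bilin 1 (ε * a) (S z)).bilinearComp ((0 : E4 →L[ℝ] E4).comp S) S + (Kerr.bilin 1 (ε * a) (S z)).bilinearComp S ((0 : E4 →L[ℝ] E4).comp S))) x (sharpAt (boostedKerrBilin L 0 (ε * M) (ε * a)) x (E4.dx 0)) e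
          - ricAt (boostedKerrBilin L 0 (ε * M) (ε * a)) x (sharpAt (boostedKerrBilin L 0 (ε * M) (ε * a)) x (E4.dx 0)) e := by
        rw [hΦd]
      rw [← hΦdε] at h
      have h' : ε * (a * Ψ ε + Φd ε) = 0 := by linear_combination h
      exact (mul_eq_zero.1 h').resolve_left hε.1.ne'
    -- (s3): the limit of `Ψ` — the row functional and the data
    obtain ⟨R, hR⟩ : ∃ R : (E4 × (E4 →L[ℝ] E4 →L[ℝ] ℝ) × (E4 →L[ℝ] E4 →L[ℝ] E4 →L[ℝ] ℝ)
        × (E4 →L[ℝ] E4 →L[ℝ] E4 →L[ℝ] E4 →L[ℝ] ℝ))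
        × ((E4 →L[ℝ] E4 →L[ℝ] ℝ) × (E4 →L[ℝ] E4 →L[ℝ] E4 →L[ℝ] ℝ)) → ℝ,
        R = fun w ↦ ricciJet (w.1.1, w.1.2.1, w.1.2.2.1 + (E4.dx 0).smulRight w.2.1,
            w.1.2.2.2 + ((E4.dx 0).smulRight w.2.2
              + (ContinuousLinearMap.smulRightL ℝ E4 (E4 →L[ℝ] E4 →L[ℝ] ℝ) (E4.dx 0)).comp w.2.2))
            (w.1.2.1.inverse (E4.dx 0)) e
          - ricciJet w.1 (w.1.2.1.inverse (E4.dx 0)) e := ⟨_, rfl⟩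
    obtain ⟨D, hD⟩ : ∃ D : ℝ → (E4 × (E4 →L[ℝ] E4 →L[ℝ] ℝ) × (E4 →L[ℝ] E4 →L[ℝ] E4 →L[ℝ] ℝ)
        × (E4 →L[ℝ] E4 →L[ℝ] E4 →L[ℝ] E4 →L[ℝ] ℝ))
        × ((E4 →L[ℝ] E4 →L[ℝ] ℝ) × (E4 →L[ℝ] E4 →L[ℝ] E4 →L[ℝ] ℝ)),
        D = fun ε ↦ ((x, KSf ε x, fderiv ℝ (KSf ε) x, fderiv ℝ (fderiv ℝ (KSf ε)) x),
          (Wf (ε * a) x, fderiv ℝ (Wf (ε * a)) x)) := ⟨_, rfl⟩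
    have key : ∀ ε : ℝ, 0 < Kerr.radius (ε * a) (S x) → Ψ ε = R (D ε) := by
      intro ε hε
      have hKm : IsMetricOn (KSf ε) (poincareInv L 0 ⁻¹' (Kerr.region (ε * a) 0 : Set E4)) := by
        rw [← hKf]; exact bk_isMetricOn_boostedKerrBilin L (ε * M) (ε * a)
      have hxK : x ∈ poincareInv L 0 ⁻¹' (Kerr.region (ε * a) 0 : Set E4) := (bk_mem_region_iff L _ x).2 hε
      have h := coerMomQ_row_eq_ricciJet hKm hxK hx0 1 (ε * a) S ((ε * a)⁻¹ • A) 0 hε e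
      rw [hΨ, hR, hD, hWf]
      exact h
    -- the limit data
    set D₀ : (E4 × (E4 →L[ℝ] E4 →L[ℝ] ℝ) × (E4 →L[ℝ] E4 →L[ℝ] E4 →L[ℝ] ℝ)
        × (E4 →L[ℝ] E4 →L[ℝ] E4 →L[ℝ] E4 →L[ℝ] ℝ))
        × ((E4 →L[ℝ] E4 →L[ℝ] ℝ) × (E4 →L[ℝ] E4 →L[ℝ] E4 →L[ℝ] ℝ)) :=
      ((x, Minkowski.bilin, 0, 0), (Sp x, fderiv ℝ Sp x)) with hD₀
    -- jets of `K_ε` at `x` tend to those of `η`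
    have hrad0 : 0 < Kerr.radius (0 * a) (S x) := by rwa [zero_mul]
    have hP : ContDiffAt ℝ ∞ (uncurry KSf) (0, x) := by
      rw [hKSf]; exact bk_contDiffAt_family₂ M a S (q₀ := ((0 : ℝ), x)) hrad0
    obtain ⟨cK0, cK1, cK2⟩ := coerMomQ_contDiffAt_jets_param hP
    have hK0 : KSf 0 = fun _ : E4 ↦ Minkowski.bilin := by
      rw [← hKf 0, zero_mul, zero_mul, bk_boostedKerrBilin_zero_mass]
    have e0 : KSf 0 x = Minkowski.bilin := by rw [hK0]
    have e1 : fderiv ℝ (KSf 0) x = 0 := by rw [hK0]; simp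
    have e2 : fderiv ℝ (fderiv ℝ (KSf 0)) x = 0 := by rw [hK0]; simp
    have tK0 : Tendsto (fun ε ↦ KSf ε x) (𝓝[>] 0) (𝓝 Minkowski.bilin) := by
      rw [← e0]; exact cK0.continuousAt.tendsto.mono_left nhdsWithin_le_nhds
    have tK1 : Tendsto (fun ε ↦ fderiv ℝ (KSf ε) x) (𝓝[>] 0) (𝓝 0) := by
      rw [← e1]; exact cK1.continuousAt.tendsto.mono_left nhdsWithin_le_nhds
    have tK2 : Tendsto (fun ε ↦ fderiv ℝ (fderiv ℝ (KSf ε)) x) (𝓝[>] 0) (𝓝 0) := by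
      rw [← e2]; exact cK2.continuousAt.tendsto.mono_left nhdsWithin_le_nhds
    -- jets of `Wf (εa)` at `x` tend to those of the spin first-variation field
    have hV0 : ∀ z : E4, 0 < Kerr.radius 0 (S z) → Vf 0 z = 0 := fun z hz ↦ by
      rw [hVf]; exact hstab z hz
    have hf0 : Vf 0 x = 0 := hV0 x hx
    have hfd : HasDerivAt (fun a' : ℝ ↦ Vf a' x) (Sp x) 0 := by
      rw [hVf, hSp]; exact bk_hasDerivAt_var_spin 1 S A 0 hx
    have hg0 : fderiv ℝ (Vf 0) x = 0 := by
      have hev0 : Vf 0 =ᶠ[𝓝 x] fun _ ↦ (0 : E4 →L[ℝ] E4 →L[ℝ] ℝ) := by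
        filter_upwards [hU.mem_nhds hx] with z hz
        exact hV0 z hz
      rw [hev0.fderiv_eq]; simp
    have hgd : HasDerivAt (fun a' : ℝ ↦ fderiv ℝ (Vf a') x) (fderiv ℝ Sp x) 0 := by
      rw [hVf, hSp]; exact bk_hasDerivAt_fderiv_var_spin 1 S A 0 hx
    have hslope0 : Tendsto (fun t : ℝ ↦ t⁻¹ • Vf t x) (𝓝[≠] 0) (𝓝 (Sp x)) :=
      bk_tendsto_inv_smul_of_hasDerivAt hfd hf0
    have hslope1 : Tendsto (fun t : ℝ ↦ t⁻¹ • fderiv ℝ (Vf t) x) (𝓝[≠] 0) (𝓝 (fderiv ℝ Sp x)) :=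
      bk_tendsto_inv_smul_of_hasDerivAt hgd hg0
    have hφ : Tendsto (fun ε : ℝ ↦ ε * a) (𝓝[>] 0) (𝓝[≠] 0) := by
      refine tendsto_nhdsWithin_of_tendsto_nhds_of_eventually_within _ ?_ ?_
      · have h := (tendsto_id (x := 𝓝 (0 : ℝ))).mul_const a
        rw [zero_mul] at h
        exact h.mono_left nhdsWithin_le_nhds
      · filter_upwards [self_mem_nhdsWithin] with ε hε
        exact mul_ne_zero (ne_of_gt hε) ha
    have tW0 : Tendsto (fun ε ↦ Wf (ε * a) x) (𝓝[>] 0) (𝓝 (Sp x)) := by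
      have h := hslope0.comp hφ
      refine h.congr fun ε ↦ ?_
      simp only [comp_apply, hWV (ε * a)]
    have tW1 : Tendsto (fun ε ↦ fderiv ℝ (Wf (ε * a)) x) (𝓝[>] 0) (𝓝 (fderiv ℝ Sp x)) := by
      have h := hslope1.comp hφ
      have h1 : ∀ᶠ ε : ℝ in 𝓝[>] 0, 0 < Kerr.radius (ε * a) (S x) :=
        hev_rad.filter_mono nhdsWithin_le_nhds
      refine h.congr' ?_
      filter_upwards [h1] with ε hεr
      have hdiff : DifferentiableAt ℝ (Vf (ε * a)) x := by
        rw [hVf]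
        exact ((coerMomQ_contDiffOn_var 1 (ε * a) S A 0).2.contDiffAt
          ((coerMomQ_contDiffOn_var 1 (ε * a) S A 0).1.mem_nhds hεr)).differentiableAt (by simp)
      rw [comp_apply, hWV (ε * a)]
      exact (fderiv_fun_const_smul hdiff _).symm
    have tD : Tendsto D (𝓝[>] 0) (𝓝 D₀) := by
      rw [hD, hD₀]
      exact (tendsto_const_nhds.prodMk_nhds (tK0.prodMk_nhds (tK1.prodMk_nhds tK2))).prodMk_nhds
        (tW0.prodMk_nhds tW1)
    -- continuity of the row functional at the limit data, and the limit of `Ψ`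
    have hinv : D₀.1.2.1.IsInvertible := isInvertible_of_nondegenerate Minkowski.bilin_nondegenerate
    have hRc : ContinuousAt R D₀ := by rw [hR]; exact coerMomQ_continuousAt_rowFun e hinv
    have hΨlim : Tendsto Ψ (𝓝[>] 0) (𝓝 (R D₀)) := by
      have h := hRc.tendsto.comp tD
      have h1 : ∀ᶠ ε : ℝ in 𝓝[>] 0, 0 < Kerr.radius (ε * a) (S x) :=
        hev_rad.filter_mono nhdsWithin_le_nhds
      exact h.congr' (by filter_upwards [h1] with ε hε; exact (key ε hε).symm)
    -- the limit value is the flat row of the spin first-variation field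
    have hGm : IsMetricOn (fun _ : E4 ↦ Minkowski.bilin) (univ : Set E4) :=
      { isOpen := isOpen_univ
        contDiffOn := contDiffOn_const
        symm := fun _ _ v w ↦ Minkowski.bilin_symm v w
        isInvertible := fun _ _ ↦ isInvertible_of_nondegenerate Minkowski.bilin_nondegenerate }
    have hSpc : ContDiffOn ℝ ∞ Sp {z : E4 | 0 < Kerr.radius 0 (S z)} := fun z hz ↦ by
      rw [hSp]; exact (bk_contDiffAt_spinVar 1 S A 0 hz).contDiffWithinAt
    have hSps : ∀ z ∈ {z : E4 | 0 < Kerr.radius 0 (S z)}, ∀ v w : E4, Sp z v w = Sp z w v :=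
      fun z hz v w ↦ by rw [hSp]; exact bk_spinVar_symm 1 S A 0 hz v w
    have hrow0 := bk_row_eq_ricciJet_field hGm (mem_univ x) hx0 hU hSpc hx hSps e
    have c1 : fderiv ℝ (fun _ : E4 ↦ Minkowski.bilin) x = 0 := by simp
    have c2 : fderiv ℝ (fderiv ℝ (fun _ : E4 ↦ Minkowski.bilin)) x = 0 := by simp
    rw [c1, c2, ricAt_constMetric] at hrow0
    simp only [_root_.zero_apply, sub_zero] at hrow0
    have hRD₀ : R D₀ = ricAt (fun z : E4 ↦ Minkowski.bilin + (z 0) • Sp z) x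
        (sharpAt (fun _ : E4 ↦ Minkowski.bilin) x (E4.dx 0)) e := by
      rw [hrow0, hR, hD₀]
      dsimp only
      rfl
    -- (s5): pass to the limit in `a Ψ ε + Φd ε = 0`
    have hsum : Tendsto (fun ε ↦ a * Ψ ε + Φd ε) (𝓝[>] 0) (𝓝 (a * R D₀ + Φd 0)) :=
      (hΨlim.const_mul a).add hdlim
    have hsum0 : Tendsto (fun ε ↦ a * Ψ ε + Φd ε) (𝓝[>] 0) (𝓝 0) :=
      tendsto_const_nhds.congr' (hid2.mono fun ε hε ↦ hε.symm)
    have hfin : a * R D₀ + Φd 0 = 0 := tendsto_nhds_unique hsum hsum0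
    rw [hRD₀, hd0, hSp] at hfin
    exact hfin

/-- **Registered carrier** `bk_limit_carrier` of the crux item (one-line form of a lemma of this file,
for the `--supports` protocol). [folklore] -/
theorem bk_limit_carrier : open Filter Topology in ∀ {f : ℝ → ℝ} {f' : ℝ}, HasDerivAt f f' 0 → f 0 = 0 → Tendsto (fun t : ℝ ↦ t⁻¹ • f t) (𝓝[≠] 0) (𝓝 f') :=
  fun hf hf0 ↦ bk_tendsto_inv_smul_of_hasDerivAt hf hf0

end Summit.FinalStateConjecture.FinalStateConjecture.Theorems.SublinearIsFree.Slaving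

end
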